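import Summits.HodgeConjecture.HodgeConjecture.Theorems.VHCAbelianSchemesRoadServedFibreAlgebraic
import HarnessLib

/-!
# Road b02 (`VHCAbelianSchemesRoad`) × the André column — THE LOCAL SERVED-FIBRE LEMMA over a smooth base of ANY dimension:
# door ∧ carrier at a served fibre ⟹ `W` is algebraic on an OPEN NEIGHBOURHOOD of that fibre (fact-free, door- and anchor-generic)

research route, not a corollary; conditional on HC_CM plus one named minimal statement.

PART AA-e (`VHCAbelianSchemesRoadServedFibreAlgebraic` §1–§2) runs the door at a served fibre of a PENCIL (smooth irreducible
ONE-dimensional base) and spreads algebraicity to every fibre through «uncountable ⟹ thick» on a curve. The OUTPUT SHAPE of every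
semiregularity theorem, however, is LOCAL and dimension-free — Buchweitz–Flenner Thm. 5.1: «`α_p(s)` is algebraic for all `s ∈ S`
near `0`»; Bloch (7.4); Markman Conj. 7.3.9: «over `π⁻¹(U)` for some open analytic neighborhood `U` of `0`» — and it is in this
local shape that the Weil ladder of the cell (`b2b-hweil`) states its anchor predicates
(`HodgeTheory.HasLocallyAlgebraicWeilAnchor`, `HodgeTheory.HasLocallyAlgebraicTensorAnchors`: «`q·H_sᵏ + W_s` algebraic for all `s`
in an open `U ∋ s₀`», base of any dimension). This file proves the local lemma that lets the road's per-variety carrier language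
(`AnchoredCarrierAt 𝒪 n p 𝔄 𝔖`, PART AA-a) FEED those predicates (companion file `Ring2AbelianAllTensorWeilCarriers`):

* §1 `exists_isOpen_forall_mem_algebraicClasses_of_pinnedDatum_at` — `f : 𝒳 ⟶ S` smooth projective of relative dimension `n` over a
  SMOOTH base (any dimension), `Θ ∈ H²(𝒳)` with rational `(1,1)` restrictions, `W ∈ H^{2p}(𝒳)` with `(p,p)` restrictions, and AT THE
  FIBRE `s₀` an `𝒪`-datum `(I ∋ p, κ)` with `κ_p = a·W| + c_p·Θ|ᵖ`, `a ≠ 0`, `κ_q = c_q·Θ|^q`: if `𝒪` satisfies its local variational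
  Hodge statement (`LocalVariationalHodgeFor 𝒪`), then `W|_{𝒳_t}` is ALGEBRAIC for every `t` in an OPEN set `U ∋ s₀` (the path component
  of `s₀` in the open set the door returns; `S(ℂ)` is locally path connected because `S` is smooth). Mechanism verbatim from AA-e §1:
  the transports of the restrictions of the GLOBAL classes `V_p = a·W + c_p·Θᵖ`, `V_q = c_q·Θ^q` are their restrictions
  (`transportFun_map_fiberι`), of type `(q,q)`; the door at the model `Iso.refl 𝒳_{s₀}` returns an open set on whose path component
  `a·W|_t + c_p·Θ|_tᵖ` is algebraic; `Θ|_tᵖ` is an algebraic Lefschetz class; divide by `a`.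
* §2 `exists_isOpen_forall_mem_algebraicClasses_of_anchoredCarrierAt_at` — the same from the ANCHORED CARRIER STATEMENT at a served fibre:
  `𝔄 (𝒳_{s₀}) (Θ|_{s₀})` and `W|_{s₀} ∈ 𝔖 (𝒳_{s₀}) (Θ|_{s₀})`, `W|_{s₀}` rational.
* §3 `exists_isOpen_forall_mem_algebraicClasses_of_anchoredCarrierAt_of_polarised` — the same for anchor predicates of the product form
  `𝔄₀ X ∧ IsPolarizationClass n X θ` and served maps that ignore `θ`, with `Θ` the relative hyperplane class of a quasi-projective total
  space over a separated base (`exists_forall_isPolarizationClass_map_fiberι`): the shape consumed by the tensor-anchor junction.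

Nothing here asserts any carrier statement, any door, any anchor predicate, VHC, `HC_AV`, `HC_CM` or HC; `HC_CM` does not occur.
References: [cite: BuchweitzFlenner2003, §5 Thm. 5.1 («for all s ∈ S near 0»)] [cite: Bloch1972Semiregularity, Thm. (7.4) and Remark (7.5)]
[cite: Markman2025SecantWeil, Conj. 7.3.9 and §1.5 (local deformation over an open neighbourhood)] [cite: VoisinHodgeI2002, §9.2.1 and Thm. 9.3]
[cite: VoisinHodgeII2003, §7.3.2].
-/

noncomputable section

open CategoryTheory CategoryTheory.Limits AlgebraicGeometry Topology

namespace Summit.HodgeConjecture.HodgeConjecture.Ring2.SemiregularRepresentatives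

-- the cell's namespace repeats the summit name (`Summit.HodgeConjecture.HodgeConjecture…`), as in every `Ring2*` file
set_option linter.dupNamespace false

open Literature.AlgebraicGeometry Literature.AlgebraicGeometry.Motives
open Literature.AlgebraicGeometry.HodgeTheory
open Literature.AlgebraicTopology.SingularHomology
open Literature.Barriers.HodgeConjecture (divisorClassesSpan)
open Summit.HodgeConjecture.HodgeConjecture.Ring2.Binders (exists_forall_isPolarizationClass_map_fiberι)
open Summit.Ventures.HSemireg (ObjClass LocalVariationalHodgeFor)

variable {𝒪 : ObjClass} {n p : ℕ}
variable {𝔄 : ∀ X : SchemeOver ℂ, complexBetti X 2 → Prop} {𝔖 : ∀ (X : SchemeOver ℂ), complexBetti X 2 → Set (complexBetti X (2 * p))}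
variable {𝒳 S : SchemeOver ℂ} {f : 𝒳 ⟶ S}

/-- Functoriality bookkeeping (`(Iso.refl X).inv^* = id`). [folklore] -/
private theorem map_refl_inv_loc (X : SchemeOver ℂ) (k : ℕ) (c : complexBetti X k) :
    complexBetti.map (Iso.refl X).inv k c = c := by
  rw [Iso.refl_inv, complexBetti.map_id]
  rfl

/-! ## §1 Door ∧ pinned datum at `s₀` ⟹ `W` algebraic on an open neighbourhood of `s₀` (smooth base of any dimension) -/

/-- **THE LOCAL SERVED-FIBRE LEMMA** (door- and degree-generic, fact-free; smooth base of ANY dimension). `f : 𝒳 ⟶ S` smooth projective of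
relative dimension `n` over a smooth `S`; `Θ ∈ H²(𝒳(ℂ); ℂ)` with rational `(1,1)` fibre restrictions, `W ∈ H^{2p}(𝒳(ℂ); ℂ)` with `(p,p)`
fibre restrictions; at the fibre `s₀` an `𝒪`-datum `(I ∋ p, κ)` with `κ_p = a·W|_{s₀} + c_p·Θ|_{s₀}ᵖ`, `a ≠ 0`, `κ_q = c_q·Θ|_{s₀}^q`
(`q ∈ I`, `q ≠ p`). If `𝒪` satisfies its local variational Hodge statement, then there is an OPEN `U ∋ s₀` in `S(ℂ)` with `W|_{𝒳_t}`
ALGEBRAIC for every `t ∈ U` — the output shape of Buchweitz–Flenner Thm. 5.1 («algebraic for all `s ∈ S` near `0`»), obtained from the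
door at the model `Iso.refl 𝒳_{s₀}` fed with the global classes `a·W + c_p·Θᵖ`, `c_q·Θ^q` (their transports are their restrictions), on
the path component of `s₀` in the returned open set; `Θ|_tᵖ` is algebraic, divide by `a`.
[cite: BuchweitzFlenner2003, §5 Thm. 5.1] [cite: Bloch1972Semiregularity, Remark (7.5)] [cite: VoisinHodgeI2002, §9.2.1 and Thm. 9.3] -/
theorem exists_isOpen_forall_mem_algebraicClasses_of_pinnedDatum_at (hT : LocalVariationalHodgeFor 𝒪)
    (hf : IsSmoothProjectiveFamily f n) (hsm : AlgebraicGeometry.Smooth S.hom) (Θ : complexBetti 𝒳 2)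
    (hΘQ : ∀ s : ComplexPoints S, IsRationalClass (complexBetti.map (fiberι f s) 2 Θ))
    (hΘH : ∀ s : ComplexPoints S, IsOfHodgeType n (fiberOver f s) 2 1 1 (complexBetti.map (fiberι f s) 2 Θ))
    (W : complexBetti 𝒳 (2 * p))
    (hWH : ∀ s : ComplexPoints S, IsOfHodgeType n (fiberOver f s) (2 * p) p p (complexBetti.map (fiberι f s) (2 * p) W))
    {s₀ : ComplexPoints S} {I : Finset ℕ} {κ : (q : ℕ) → complexBetti (fiberOver f s₀) (2 * q)} {a : ℂ} {c : ℕ → ℂ}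
    (hpI : p ∈ I) (h𝒪 : 𝒪 n (fiberOver f s₀) I κ) (ha : a ≠ 0)
    (hκp : κ p = a • complexBetti.map (fiberι f s₀) (2 * p) W + c p • cupPowTwo (complexBetti.map (fiberι f s₀) 2 Θ) p)
    (hκq : ∀ q ∈ I, q ≠ p → κ q = c q • cupPowTwo (complexBetti.map (fiberι f s₀) 2 Θ) q) :
    ∃ U : Set (ComplexPoints S), IsOpen U ∧ s₀ ∈ U ∧
      ∀ t ∈ U, complexBetti.map (fiberι f t) (2 * p) W ∈ algebraicClasses (fiberOver f t) p := by
  haveI := hsm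
  haveI : LocallyOfFiniteType S.hom := inferInstance
  haveI : LocallyPathConnectedSpace (ComplexPoints S) := locallyPathConnectedSpace_complexPoints_of_smooth S
  have hU : IsCohomologicallyLocallyTrivialOn f (Set.univ : Set (ComplexPoints S)) :=
    isCohomologicallyLocallyTrivialOn_univ_of_isSmoothProjectiveFamily_of_smooth f hf
  -- `(Θᵖ)|` is a Lefschetz class, hence algebraic, on every fibre
  have hΘalg : ∀ s : ComplexPoints S,
      complexBetti.map (fiberι f s) (2 * p) (cupPowTwo Θ p) ∈ algebraicClasses (fiberOver f s) p := fun s ↦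
    divisorClassesSpan_le_algebraicClasses_of_isSmoothProjective (hf.isSmoothProjective s) p
      (by simpa only [one_smul] using smul_cupPowTwo_map_mem_divisorClassesSpan Θ s (hΘQ s) (hΘH s) 1 p)
  -- the global classes whose restrictions at `s₀` are the `κ_q`
  let V : (q : ℕ) → complexBetti 𝒳 (2 * q) :=
    Function.update (fun q ↦ c q • cupPowTwo Θ q) p (a • W + c p • cupPowTwo Θ p)
  have hVp : V p = a • W + c p • cupPowTwo Θ p := Function.update_self _ _ _
  have hVq : ∀ q, q ≠ p → V q = c q • cupPowTwo Θ q := fun q hq ↦ Function.update_of_ne hq _ _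
  have hκV : ∀ q ∈ I, κ q = complexBetti.map (fiberι f s₀) (2 * q) (V q) := by
    intro q hq
    by_cases hqp : q = p
    · subst hqp
      rw [hVp, map_add, map_smul, map_smul, map_cupPowTwo _ Θ q]
      exact hκp
    · rw [hVq q hqp, map_smul, map_cupPowTwo _ Θ q]
      exact hκq q hq hqp
  have hVH : ∀ q ∈ I, ∀ s : ComplexPoints S,
      IsOfHodgeType n (fiberOver f s) (2 * q) q q (complexBetti.map (fiberι f s) (2 * q) (V q)) := by
    intro q _ s
    by_cases hqp : q = p
    · subst hqp
      rw [hVp, map_add, map_smul]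
      exact ((hWH s).smul a).add (hf.isSmoothProjective s) (isOfHodgeType_map_smul_cupPowTwo hf Θ s (hΘH s) (c q) q)
    · rw [hVq q hqp]
      exact isOfHodgeType_map_smul_cupPowTwo hf Θ s (hΘH s) (c q) q
  -- the door at the model `Iso.refl 𝒳_{s₀}`
  let s₀' : (Set.univ : Set (ComplexPoints S)) := ⟨s₀, Set.mem_univ s₀⟩
  have hHodge : ∀ q ∈ I, ∀ (t : (Set.univ : Set (ComplexPoints S))) (γ : Path.Homotopic.Quotient s₀' t),
      IsOfHodgeType n (fiberOver f t.1) (2 * q) q q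
        (transportFun f (2 * q) hU γ (complexBetti.map (Iso.refl (fiberOver f s₀)).inv (2 * q) (κ q))) := by
    intro q hq t γ
    rw [map_refl_inv_loc, hκV q hq, transportFun_map_fiberι f (2 * q) hU γ (V q)]
    exact hVH q hq t.1
  obtain ⟨W', hWo, hW'₀, hWU, hW'⟩ := hT f n hf hsm hU s₀' (fiberOver f s₀) (Iso.refl _) I κ h𝒪 hHodge
  refine ⟨pathComponentIn W' s₀, hWo.pathComponentIn s₀, mem_pathComponentIn_self hW'₀, fun t ht ↦ ?_⟩
  -- `W` is algebraic on the path component of `s₀` in `W'`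
  have hj : JoinedIn W' s₀ t := ht
  have hpm : ∀ u, hj.somePath u ∈ W' := hj.somePath_mem
  let γ : Path (⟨s₀, hW'₀⟩ : W') ⟨t, pathComponentIn_subset ht⟩ :=
    { toFun := fun u ↦ ⟨hj.somePath u, hpm u⟩
      continuous_toFun := hj.somePath.continuous.subtype_mk _
      source' := Subtype.ext hj.somePath.source
      target' := Subtype.ext hj.somePath.target }
  have hmem := hW' p hpI ⟨t, pathComponentIn_subset ht⟩ ⟦γ⟧
  have htr : transportFun f (2 * p) (hU.mono hWU hWo) ⟦γ⟧
      (complexBetti.map (Iso.refl (fiberOver f s₀)).inv (2 * p) (κ p)) =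
      a • complexBetti.map (fiberι f t) (2 * p) W + c p • complexBetti.map (fiberι f t) (2 * p) (cupPowTwo Θ p) := by
    rw [map_refl_inv_loc, hκV p hpI, transportFun_map_fiberι f (2 * p) (hU.mono hWU hWo) ⟦γ⟧ (V p), hVp, map_add, map_smul,
      map_smul]
  change transportFun f (2 * p) (hU.mono hWU hWo) ⟦γ⟧
      (complexBetti.map (Iso.refl (fiberOver f s₀)).inv (2 * p) (κ p)) ∈ _ at hmem
  rw [htr] at hmem
  have hWt : complexBetti.map (fiberι f t) (2 * p) W =
      a⁻¹ • ((a • complexBetti.map (fiberι f t) (2 * p) W + c p • complexBetti.map (fiberι f t) (2 * p) (cupPowTwo Θ p)) -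
        c p • complexBetti.map (fiberι f t) (2 * p) (cupPowTwo Θ p)) := by
    rw [add_sub_cancel_right, smul_smul, inv_mul_cancel₀ ha, one_smul]
  rw [hWt]
  exact Submodule.smul_mem _ _ (Submodule.sub_mem _ hmem (Submodule.smul_mem _ _ (hΘalg t)))

/-! ## §2 … from the anchored carrier statement at a served fibre -/

/-- **DOOR ∧ ANCHORED CARRIER AT A SERVED FIBRE ⟹ `W` ALGEBRAIC ON AN OPEN NEIGHBOURHOOD OF THAT FIBRE** (door-, degree-, anchor-generic;
fact-free; smooth base of any dimension): with `Θ`, `W` as in §1, if the fibre `𝒳_{s₀}` with `Θ|_{s₀}` is an anchor (`𝔄`) at which the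
RATIONAL class `W|_{s₀}` is served (`𝔖`), the anchored carrier statement supplies the datum of §1 at `s₀`. The LOCAL output shape of an
anchor («algebraic for all `s` near `s₀`», BF Thm. 5.1; Markman §1.5) in the road's carrier language.
[cite: BuchweitzFlenner2003, §5 Thm. 5.1] [cite: Markman2025SecantWeil, §1.5 and Thm. 1.5.1] [cite: Bloch1972Semiregularity, Remark (7.5)] -/
theorem exists_isOpen_forall_mem_algebraicClasses_of_anchoredCarrierAt_at (hT : LocalVariationalHodgeFor 𝒪)
    (hA : AnchoredCarrierAt 𝒪 n p 𝔄 𝔖) (hf : IsSmoothProjectiveFamily f n) (hsm : AlgebraicGeometry.Smooth S.hom)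
    (Θ : complexBetti 𝒳 2) (hΘQ : ∀ s : ComplexPoints S, IsRationalClass (complexBetti.map (fiberι f s) 2 Θ))
    (hΘH : ∀ s : ComplexPoints S, IsOfHodgeType n (fiberOver f s) 2 1 1 (complexBetti.map (fiberι f s) 2 Θ))
    (W : complexBetti 𝒳 (2 * p))
    (hW : ∀ s : ComplexPoints S, IsRationalClass (complexBetti.map (fiberι f s) (2 * p) W) ∧
      IsOfHodgeType n (fiberOver f s) (2 * p) p p (complexBetti.map (fiberι f s) (2 * p) W))
    (s₀ : ComplexPoints S) (hanc : 𝔄 (fiberOver f s₀) (complexBetti.map (fiberι f s₀) 2 Θ))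
    (hserved : complexBetti.map (fiberι f s₀) (2 * p) W ∈ 𝔖 (fiberOver f s₀) (complexBetti.map (fiberι f s₀) 2 Θ)) :
    ∃ U : Set (ComplexPoints S), IsOpen U ∧ s₀ ∈ U ∧
      ∀ t ∈ U, complexBetti.map (fiberι f t) (2 * p) W ∈ algebraicClasses (fiberOver f t) p := by
  obtain ⟨I, κ, a, c, hpI, h𝒪, ha, hκp, hκq⟩ := hA (fiberOver f s₀) _ hanc _ hserved (hW s₀).1
  exact exists_isOpen_forall_mem_algebraicClasses_of_pinnedDatum_at hT hf hsm Θ hΘQ hΘH W (fun s ↦ (hW s).2) hpI h𝒪 ha hκp hκq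

/-! ## §3 … for polarised anchor predicates, with the relative hyperplane class -/

/-- **The local lemma for anchor data of the product form «`𝔄₀ X` and `θ` a polarisation class» with a served map that ignores `θ`**
(the shape of the André column's CM / elliptic-power anchors and of the tensor anchors of the companion file): over a SEPARATED smooth
base with QUASI-PROJECTIVE total space the relative hyperplane class `Θ` polarises every fibre
(`exists_forall_isPolarizationClass_map_fiberι`), so it suffices that `𝔄₀ (𝒳_{s₀})` hold and `W|_{s₀}` be served.
[cite: BuchweitzFlenner2003, §5 Thm. 5.1] [cite: VoisinHodgeI2002, Thm. 7.10 and §7.1.2] [cite: Bloch1972Semiregularity, Remark (7.5)] -/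
theorem exists_isOpen_forall_mem_algebraicClasses_of_anchoredCarrierAt_of_polarised (hT : LocalVariationalHodgeFor 𝒪)
    {𝔄₀ : SchemeOver ℂ → Prop} {𝔖₀ : ∀ X : SchemeOver ℂ, Set (complexBetti X (2 * p))}
    (hA : AnchoredCarrierAt 𝒪 n p (fun X θ ↦ 𝔄₀ X ∧ IsPolarizationClass n X θ) (fun X _ ↦ 𝔖₀ X))
    (hf : IsSmoothProjectiveFamily f n) (h𝒳 : IsQuasiProjectiveOver 𝒳) [IsSeparated S.hom] (hsm : AlgebraicGeometry.Smooth S.hom)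
    (W : complexBetti 𝒳 (2 * p))
    (hW : ∀ s : ComplexPoints S, IsRationalClass (complexBetti.map (fiberι f s) (2 * p) W) ∧
      IsOfHodgeType n (fiberOver f s) (2 * p) p p (complexBetti.map (fiberι f s) (2 * p) W))
    (s₀ : ComplexPoints S) (hanc : 𝔄₀ (fiberOver f s₀)) (hserved : complexBetti.map (fiberι f s₀) (2 * p) W ∈ 𝔖₀ (fiberOver f s₀)) :
    ∃ U : Set (ComplexPoints S), IsOpen U ∧ s₀ ∈ U ∧
      ∀ t ∈ U, complexBetti.map (fiberι f t) (2 * p) W ∈ algebraicClasses (fiberOver f t) p := by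
  obtain ⟨Θ, hΘ⟩ := exists_forall_isPolarizationClass_map_fiberι f hf h𝒳
  exact exists_isOpen_forall_mem_algebraicClasses_of_anchoredCarrierAt_at hT hA hf hsm Θ (fun s ↦ (hΘ s).isRationalClass)
    (fun s ↦ isOfHodgeType_of_mem_algebraicClasses_of_isSmoothProjective (hf.isSmoothProjective s) 1 (hΘ s).mem_algebraicClasses)
    W hW s₀ ⟨hanc, hΘ s₀⟩ hserved

end Summit.HodgeConjecture.HodgeConjecture.Ring2.SemiregularRepresentatives

end
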